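/-
Copyright: the b2b-balaban T⁴-continuum CRUX team, row NE7b OWNER lineage `t4-ne7b-p1` (gen 136). Project licence.
-/
import Literature.Probability.Distributions.GaussianQuadraticTilt

/-!
# ABSORPTION OF THE EXTRACTED GAUSSIAN PART INTO THE NEXT FLUCTUATION MEASURE — (α4)'s ENTRY, MEASURE HALF: for a fluctuation
# Gaussian `N(0, P⁻¹)` (precision `P ≻ 0`), a symmetric matrix `K` with `P + K ≻ 0` and a vector `b`, the quadratic-exponential weight
# `e^{−½xᵀKx + bᵀx}` is ABSORBED by a change of Gaussian:
#   `N(0,P⁻¹)` with density `e^{−½xᵀKx + bᵀx}`  =  `c • N(m, (P+K)⁻¹)`,  `m = (P+K)⁻¹b`,  `c = (Z_{P+K}∕Z_P)·e^{½bᵀ(P+K)⁻¹b} = E_{N(0,P⁻¹)}[e^{−½xᵀKx+bᵀx}]`,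
# hence for EVERY integrand `F` (any real normed space, no integrability needed on either side)
#   `∫ e^{−½xᵀKx + bᵀx}·F(x) N(0,P⁻¹)(dx) = (∫ e^{−½xᵀKx + bᵀx} N(0,P⁻¹)(dx)) · ∫ F N(m,(P+K)⁻¹)(dx)`:
# the quadratic part DRESSES the covariance (`Γ' ↦ (Γ'⁻¹ + K)⁻¹`), the linear part SHIFTS the mean, and what is left is ONE NUMBER per step
# (row NE7b, node U5c; the tree's `GaussianToolkit` ∕ `GaussianQuadraticTilt` BY NAME; [folklore])

Cell `pub-balaban`, sub-cell `t4`, spine estimate NE7b (`T4WeightBudget.RelWeightBound`; the cell's OWN estimate — NOT PRINTED in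
[Bałaban 1983–89], NOT PROVED).  Crux-route work under `Spine/NE7b/` by the row OWNER (`t4-ne7b-p1` gen 136, file (385)) under FREEZE
(0)'s crux-prover clause, on gen 135's SCOPING-d7 DECISION (d7′)(2′)(iii) («absorption of `e^{−⟨b,ψ⟩−½⟨ψ,Kψ⟩}` into the next Gaussian»);
NOTHING of Bałaban's is named as a Lean object, valued or asserted; no `T4Continuum/Support` leaf typed; no `def`, no notation; zero `sorry`.
Imports (BY NAME): the tree's `Literature.Probability.Distributions.GaussianQuadraticTilt` (`neg_half_quadratic_add_linear_eq`,
`transpose_eq_of_posDef`, `gaussZ_toReal_eq`) and through it `GaussianToolkit` (`gaussWeight`, `gaussZ`, `multivariateGaussian_inv_eq_withDensity`,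
`measurable_gaussWeight`); Mathlib's `multivariateGaussian`, `withDensity_mul`, `withDensity_smul`, `map_add_right_eq_self`,
`integral_withDensity_eq_integral_toReal_smul`, `integral_smul_measure`.

WHAT IS PROVED ([folklore]):
* §1 `multivariateGaussian_map_add` (`N(0,S)` translated by `μ` is `N(μ,S)` — Mathlib's definition unfolded), `withDensity_eq_smul_multivariateGaussian`
  (`e^{−½xᵀQx}dx = Z_Q • N(0,Q⁻¹)`), `gaussWeight_mul_tilt_eq` (completing the square at the level of densities:
  `e^{−½xᵀPx}·e^{−½xᵀKx+bᵀx} = e^{½bᵀQ⁻¹b}·e^{−½(x−m)ᵀQ(x−m)}`, `Q = P + K`, `m = Q⁻¹b`);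
* §2 **`absorption_measure`** — THE MEASURE IDENTITY `N(0,P⁻¹).withDensity(e^{−½xᵀKx+bᵀx}) = (Z_P⁻¹·Z_Q·e^{½bᵀQ⁻¹b}) • N(m, Q⁻¹)`;
* §3 **`absorption_integral`** — for every `F : ℝ^ι → G`: `∫ e^{−½xᵀKx+bᵀx}•F dN(0,P⁻¹) = (Z_Q∕Z_P·e^{½bᵀQ⁻¹b}) • ∫ F dN(m,Q⁻¹)`,
  `absorption_const_eq_integral` (the constant IS the tilted mass `∫e^{−½xᵀKx+bᵀx}dN(0,P⁻¹)`), **`absorption_normalised`** (the product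
  form displayed above), `absorption_const_closed_form` (`Z_Q∕Z_P = √(det P∕det Q)`);
* §4 `absorption_integral_cov` — the same with a positive definite COVARIANCE `S` (`P = S⁻¹`, dressed covariance `(S⁻¹ + K)⁻¹`), and
  `absorption_integral_neg` — the road's sign convention `e^{−⟨b,x⟩ − ½⟨x,Kx⟩}` (mean `−(S⁻¹+K)⁻¹b`); §5 toy.

HONEST (what this is NOT).  Finite-dimensional Gaussian calculus: NO claim that the road's `K_D = Hess W_D(0)` keeps `Γ'⁻¹ + K ≻ 0` with a
margin along the scales (that is the dressed column (233)–(256) ∕ the two-sided second-order class (322), to be fed here), NO contraction, NO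
estimate of the one number `c` beyond its closed form; scalar skeleton ((A3), NC-NE7b-α UNRULED); nothing of Bałaban's asserted.  BY-NAME
EFFECT ON THE WALL: NONE.  NE7b NOT PRINTED ∕ NOT PROVED; spine PROVED 0∕9; rung (B)+1 — the programme's measures remain FINITE-torus
statements; NOT the mass gap, NOT Clay.  HONEST DEPENDENCY: continuum YM on T⁴ ⇐ BetaPertH ∧ nine spine estimates (0∕9 proved); BetaPertH ⇐
(D1) ∧ (D4) ∧ CAP+tail; G-an2-4 gates asym, D1 and NE2∕3∕4.
-/

set_option autoImplicit false

noncomputable section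

namespace Summit.QuantumFields.BalabanUV.T4Continuum.NE7b.SupGaussianQuadraticAbsorption

open MeasureTheory ProbabilityTheory Matrix WithLp Real
open scoped ENNReal NNReal MatrixOrder BigOperators
open Literature.MathematicalPhysics.QuantumFieldTheory.GaussianToolkit
open Literature.Probability.Distributions (neg_half_quadratic_add_linear_eq transpose_eq_of_posDef gaussZ_toReal_eq)

variable {ι : Type*} [Fintype ι] [DecidableEq ι]

/-! ## §1. Translation, density of `N(0,Q⁻¹)`, completing the square -/

/-- **Translating `N(0,S)` by `μ` gives `N(μ,S)`** (Mathlib's `multivariateGaussian μ S` is the image of the standard Gaussian under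
`x ↦ μ + √S x`). [folklore] -/
theorem multivariateGaussian_map_add (μ : EuclideanSpace ℝ ι) (S : Matrix ι ι ℝ) :
    (multivariateGaussian 0 S).map (fun x => x + μ) = multivariateGaussian μ S := by
  unfold multivariateGaussian
  rw [Measure.map_map (measurable_add_const μ) (by fun_prop)]
  congr 1
  funext x
  simp only [Function.comp_apply, zero_add, add_comm]

/-- **`e^{−½xᵀQx}dx = Z_Q • N(0,Q⁻¹)`** for positive definite `Q` (the toolkit's density statement, inverted). [folklore] -/
theorem withDensity_eq_smul_multivariateGaussian {Q : Matrix ι ι ℝ} (hQ : Q.PosDef) :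
    (volume : Measure (EuclideanSpace ℝ ι)).withDensity (gaussWeight Q) = gaussZ Q • multivariateGaussian 0 Q⁻¹ := by
  obtain ⟨h, h0, htop⟩ := multivariateGaussian_inv_eq_withDensity hQ
  rw [h, smul_smul, ENNReal.mul_inv_cancel h0 htop, one_smul]

/-- `Q⁻¹` is symmetric for positive definite `Q`. [folklore] -/
theorem transpose_inv_eq_of_posDef {Q : Matrix ι ι ℝ} (hQ : Q.PosDef) : (Q⁻¹)ᵀ = Q⁻¹ := by
  rw [Matrix.transpose_nonsing_inv, transpose_eq_of_posDef hQ]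

/-- **Completing the square, scalar form**: `−½xᵀPx + (−½xᵀKx + bᵀx) = −½(x−m)ᵀQ(x−m) + ½bᵀQ⁻¹b` with `Q = P + K`, `m = Q⁻¹b`
(`Q ≻ 0`). [folklore] -/
theorem complete_square (P K : Matrix ι ι ℝ) (hQ : (P + K).PosDef) (b x : ι → ℝ) :
    -(x ⬝ᵥ P *ᵥ x) / 2 + (-(x ⬝ᵥ K *ᵥ x) / 2 + b ⬝ᵥ x) =
      -((x - (P + K)⁻¹ *ᵥ b) ⬝ᵥ (P + K) *ᵥ (x - (P + K)⁻¹ *ᵥ b)) / 2 + (b ⬝ᵥ (P + K)⁻¹ *ᵥ b) / 2 := by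
  rw [← neg_half_quadratic_add_linear_eq hQ b x, Matrix.add_mulVec, dotProduct_add]
  ring

/-- **Completing the square at the level of densities**: `e^{−½xᵀPx}·e^{−½xᵀKx+bᵀx} = e^{½bᵀQ⁻¹b}·e^{−½(x−m)ᵀQ(x−m)}` as `ℝ≥0∞`-valued
weights on `ℝ^ι`. [folklore] -/
theorem gaussWeight_mul_tilt_eq (P K : Matrix ι ι ℝ) (hQ : (P + K).PosDef) (b : ι → ℝ) (x : EuclideanSpace ℝ ι) :
    gaussWeight P x * ENNReal.ofReal (Real.exp (-(ofLp x ⬝ᵥ K *ᵥ ofLp x) / 2 + b ⬝ᵥ ofLp x)) =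
      ENNReal.ofReal (Real.exp ((b ⬝ᵥ (P + K)⁻¹ *ᵥ b) / 2)) *
        gaussWeight (P + K) (x - toLp 2 ((P + K)⁻¹ *ᵥ b)) := by
  unfold gaussWeight
  rw [← ENNReal.ofReal_mul (Real.exp_pos _).le, ← ENNReal.ofReal_mul (Real.exp_pos _).le, ← Real.exp_add, ← Real.exp_add,
    complete_square P K hQ b, WithLp.ofLp_sub, WithLp.ofLp_toLp, add_comm]

omit [DecidableEq ι] in
/-- The tilt weight is measurable. [folklore] -/
theorem measurable_tilt (K : Matrix ι ι ℝ) (b : ι → ℝ) :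
    Measurable fun x : EuclideanSpace ℝ ι => ENNReal.ofReal (Real.exp (-(ofLp x ⬝ᵥ K *ᵥ ofLp x) / 2 + b ⬝ᵥ ofLp x)) := by
  refine ENNReal.measurable_ofReal.comp (Real.measurable_exp.comp ?_)
  refine Continuous.measurable ?_
  have h : Continuous fun x : EuclideanSpace ℝ ι => (ofLp x : ι → ℝ) := PiLp.continuous_ofLp 2 _
  exact ((h.dotProduct (continuous_const.matrix_mulVec h)).neg.div_const _).add (continuous_const.dotProduct h)

/-! ## §2. THE MEASURE IDENTITY -/

/-- **ABSORPTION — THE MEASURE IDENTITY.**  `P ≻ 0`, `P + K ≻ 0` ⟹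
`N(0,P⁻¹).withDensity(e^{−½xᵀKx+bᵀx}) = (Z_P⁻¹·Z_{P+K}·e^{½bᵀ(P+K)⁻¹b}) • N((P+K)⁻¹b, (P+K)⁻¹)`. [folklore] -/
theorem absorption_measure {P : Matrix ι ι ℝ} (hP : P.PosDef) (K : Matrix ι ι ℝ) (hQ : (P + K).PosDef) (b : ι → ℝ) :
    (multivariateGaussian 0 P⁻¹).withDensity
        (fun x => ENNReal.ofReal (Real.exp (-(ofLp x ⬝ᵥ K *ᵥ ofLp x) / 2 + b ⬝ᵥ ofLp x))) =
      ((gaussZ P)⁻¹ * gaussZ (P + K) * ENNReal.ofReal (Real.exp ((b ⬝ᵥ (P + K)⁻¹ *ᵥ b) / 2))) •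
        multivariateGaussian (toLp 2 ((P + K)⁻¹ *ᵥ b)) (P + K)⁻¹ := by
  obtain ⟨hPd, -, -⟩ := multivariateGaussian_inv_eq_withDensity hP
  set m : EuclideanSpace ℝ ι := toLp 2 ((P + K)⁻¹ *ᵥ b) with hm
  rw [hPd, withDensity_smul_measure, ← withDensity_mul _ (measurable_gaussWeight P) (measurable_tilt K b)]
  have hpt : (gaussWeight P * fun x => ENNReal.ofReal (Real.exp (-(ofLp x ⬝ᵥ K *ᵥ ofLp x) / 2 + b ⬝ᵥ ofLp x))) =
      ENNReal.ofReal (Real.exp ((b ⬝ᵥ (P + K)⁻¹ *ᵥ b) / 2)) • fun x => gaussWeight (P + K) (x - m) := by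
    funext x
    simp only [Pi.mul_apply, Pi.smul_apply, smul_eq_mul]
    exact gaussWeight_mul_tilt_eq P K hQ b x
  have hms : Measurable fun x : EuclideanSpace ℝ ι => gaussWeight (P + K) (x - m) :=
    (measurable_gaussWeight (P + K)).comp (measurable_sub_const m)
  rw [hpt, withDensity_smul _ hms]
  -- translate: `(e^{−½(·−m)ᵀQ(·−m)})dx = (e^{−½xᵀQx}dx).map (· + m)`
  have htr : (volume : Measure (EuclideanSpace ℝ ι)).withDensity (fun x => gaussWeight (P + K) (x - m)) =
      ((volume : Measure (EuclideanSpace ℝ ι)).withDensity (gaussWeight (P + K))).map (fun x => x + m) := by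
    have h := map_withDensity_equiv (MeasurableEquiv.addRight m) (volume : Measure (EuclideanSpace ℝ ι)) (gaussWeight (P + K))
    have hvol : (volume : Measure (EuclideanSpace ℝ ι)).map (fun x => x + m) = volume := map_add_right_eq_self _ _
    rw [MeasurableEquiv.coe_addRight] at h
    rw [hvol] at h
    rw [h]
    congr 1
  rw [htr, withDensity_eq_smul_multivariateGaussian hQ, Measure.map_smul, multivariateGaussian_map_add, smul_smul, smul_smul,
    mul_right_comm]

/-! ## §3. THE INTEGRAL IDENTITY — every integrand, no integrability needed -/

section Integral

variable {G : Type*} [NormedAddCommGroup G] [NormedSpace ℝ G]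

/-- **ABSORPTION — THE INTEGRAL IDENTITY.**  For EVERY `F : ℝ^ι → G`:
`∫ e^{−½xᵀKx+bᵀx}•F(x) N(0,P⁻¹)(dx) = (Z_{P+K}∕Z_P·e^{½bᵀ(P+K)⁻¹b}) • ∫ F N((P+K)⁻¹b,(P+K)⁻¹)(dx)` (both sides are `0` together when
`F` is not integrable). [folklore] -/
theorem absorption_integral {P : Matrix ι ι ℝ} (hP : P.PosDef) (K : Matrix ι ι ℝ) (hQ : (P + K).PosDef) (b : ι → ℝ)
    (F : EuclideanSpace ℝ ι → G) :
    ∫ x, Real.exp (-(ofLp x ⬝ᵥ K *ᵥ ofLp x) / 2 + b ⬝ᵥ ofLp x) • F x ∂(multivariateGaussian 0 P⁻¹) =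
      ((gaussZ (P + K)).toReal / (gaussZ P).toReal * Real.exp ((b ⬝ᵥ (P + K)⁻¹ *ᵥ b) / 2)) •
        ∫ x, F x ∂(multivariateGaussian (toLp 2 ((P + K)⁻¹ *ᵥ b)) (P + K)⁻¹) := by
  have h := integral_withDensity_eq_integral_toReal_smul (μ := multivariateGaussian 0 P⁻¹) (measurable_tilt K b)
    (Filter.Eventually.of_forall fun x => ENNReal.ofReal_lt_top) F
  simp only [ENNReal.toReal_ofReal (Real.exp_pos _).le] at h
  rw [← h, absorption_measure hP K hQ b, integral_smul_measure]
  congr 1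
  rw [ENNReal.toReal_mul, ENNReal.toReal_mul, ENNReal.toReal_inv, ENNReal.toReal_ofReal (Real.exp_pos _).le]
  ring

/-- **The absorption constant IS the tilted mass**: `Z_{P+K}∕Z_P·e^{½bᵀ(P+K)⁻¹b} = ∫ e^{−½xᵀKx+bᵀx} N(0,P⁻¹)(dx)`. [folklore] -/
theorem absorption_const_eq_integral {P : Matrix ι ι ℝ} (hP : P.PosDef) (K : Matrix ι ι ℝ) (hQ : (P + K).PosDef) (b : ι → ℝ) :
    (gaussZ (P + K)).toReal / (gaussZ P).toReal * Real.exp ((b ⬝ᵥ (P + K)⁻¹ *ᵥ b) / 2) =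
      ∫ x, Real.exp (-(ofLp x ⬝ᵥ K *ᵥ ofLp x) / 2 + b ⬝ᵥ ofLp x) ∂(multivariateGaussian 0 P⁻¹) := by
  have h := absorption_integral hP K hQ b (fun _ => (1 : ℝ))
  simp only [smul_eq_mul, mul_one, integral_const, probReal_univ] at h
  simpa using h.symm

/-- **ABSORPTION, NORMALISED FORM**: for EVERY `F`,
`∫ e^{−½xᵀKx+bᵀx}•F dN(0,P⁻¹) = (∫ e^{−½xᵀKx+bᵀx} dN(0,P⁻¹)) • ∫ F dN((P+K)⁻¹b,(P+K)⁻¹)` — the extracted Gaussian part changes the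
fluctuation measure to the DRESSED, SHIFTED Gaussian at the cost of ONE NUMBER. [folklore] -/
theorem absorption_normalised {P : Matrix ι ι ℝ} (hP : P.PosDef) (K : Matrix ι ι ℝ) (hQ : (P + K).PosDef) (b : ι → ℝ)
    (F : EuclideanSpace ℝ ι → G) :
    ∫ x, Real.exp (-(ofLp x ⬝ᵥ K *ᵥ ofLp x) / 2 + b ⬝ᵥ ofLp x) • F x ∂(multivariateGaussian 0 P⁻¹) =
      (∫ x, Real.exp (-(ofLp x ⬝ᵥ K *ᵥ ofLp x) / 2 + b ⬝ᵥ ofLp x) ∂(multivariateGaussian 0 P⁻¹)) •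
        ∫ x, F x ∂(multivariateGaussian (toLp 2 ((P + K)⁻¹ *ᵥ b)) (P + K)⁻¹) := by
  rw [absorption_integral hP K hQ b F, absorption_const_eq_integral hP K hQ b]

/-- **Closed form of the constant**: `Z_{P+K}∕Z_P = √(det P)∕√(det(P+K))`. [folklore] -/
theorem absorption_const_closed_form {P : Matrix ι ι ℝ} (hP : P.PosDef) (K : Matrix ι ι ℝ) (hQ : (P + K).PosDef) :
    (gaussZ (P + K)).toReal / (gaussZ P).toReal = Real.sqrt P.det / Real.sqrt (P + K).det := by
  have hπ : (0 : ℝ) < Real.sqrt (2 * π) ^ Fintype.card ι := pow_pos (Real.sqrt_pos.2 (by positivity)) _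
  have hdP : 0 < Real.sqrt P.det := Real.sqrt_pos.2 hP.det_pos
  have hdQ : 0 < Real.sqrt (P + K).det := Real.sqrt_pos.2 hQ.det_pos
  rw [gaussZ_toReal_eq hP, gaussZ_toReal_eq hQ]
  field_simp

/-- The tilted mass is positive. [folklore] -/
theorem absorption_const_pos {P : Matrix ι ι ℝ} (hP : P.PosDef) (K : Matrix ι ι ℝ) (hQ : (P + K).PosDef) (b : ι → ℝ) :
    0 < ∫ x, Real.exp (-(ofLp x ⬝ᵥ K *ᵥ ofLp x) / 2 + b ⬝ᵥ ofLp x) ∂(multivariateGaussian 0 P⁻¹) := by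
  rw [← absorption_const_eq_integral hP K hQ b, absorption_const_closed_form hP K hQ]
  exact mul_pos (div_pos (Real.sqrt_pos.2 hP.det_pos) (Real.sqrt_pos.2 hQ.det_pos)) (Real.exp_pos _)

end Integral

/-! ## §4. Covariance form and the road's sign convention -/

section Covariance

variable {G : Type*} [NormedAddCommGroup G] [NormedSpace ℝ G]

/-- `S⁻¹ ≻ 0` and `(S⁻¹)⁻¹ = S` for `S ≻ 0`. [folklore] -/
theorem inv_inv_of_posDef {S : Matrix ι ι ℝ} (hS : S.PosDef) : (S⁻¹)⁻¹ = S :=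
  Matrix.nonsing_inv_nonsing_inv S ((Matrix.isUnit_iff_isUnit_det _).1 hS.isUnit)

/-- **ABSORPTION, COVARIANCE FORM**: `S ≻ 0`, `S⁻¹ + K ≻ 0` ⟹ for EVERY `F`,
`∫ e^{−½xᵀKx+bᵀx}•F dN(0,S) = (∫ e^{−½xᵀKx+bᵀx} dN(0,S)) • ∫ F dN((S⁻¹+K)⁻¹b, (S⁻¹+K)⁻¹)` — the DRESSED covariance `(S⁻¹+K)⁻¹` and
the SHIFTED mean `(S⁻¹+K)⁻¹b`. [folklore] -/
theorem absorption_integral_cov {S : Matrix ι ι ℝ} (hS : S.PosDef) (K : Matrix ι ι ℝ) (hQ : (S⁻¹ + K).PosDef) (b : ι → ℝ)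
    (F : EuclideanSpace ℝ ι → G) :
    ∫ x, Real.exp (-(ofLp x ⬝ᵥ K *ᵥ ofLp x) / 2 + b ⬝ᵥ ofLp x) • F x ∂(multivariateGaussian 0 S) =
      (∫ x, Real.exp (-(ofLp x ⬝ᵥ K *ᵥ ofLp x) / 2 + b ⬝ᵥ ofLp x) ∂(multivariateGaussian 0 S)) •
        ∫ x, F x ∂(multivariateGaussian (toLp 2 ((S⁻¹ + K)⁻¹ *ᵥ b)) (S⁻¹ + K)⁻¹) := by
  have h := absorption_normalised hS.inv K hQ b F
  rwa [inv_inv_of_posDef hS] at h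

/-- The tilted mass in covariance form is positive and has the closed form `√(det S⁻¹∕det(S⁻¹+K))·e^{½bᵀ(S⁻¹+K)⁻¹b}`. [folklore] -/
theorem absorption_const_cov {S : Matrix ι ι ℝ} (hS : S.PosDef) (K : Matrix ι ι ℝ) (hQ : (S⁻¹ + K).PosDef) (b : ι → ℝ) :
    ∫ x, Real.exp (-(ofLp x ⬝ᵥ K *ᵥ ofLp x) / 2 + b ⬝ᵥ ofLp x) ∂(multivariateGaussian 0 S) =
        Real.sqrt (S⁻¹).det / Real.sqrt (S⁻¹ + K).det * Real.exp ((b ⬝ᵥ (S⁻¹ + K)⁻¹ *ᵥ b) / 2) ∧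
      0 < ∫ x, Real.exp (-(ofLp x ⬝ᵥ K *ᵥ ofLp x) / 2 + b ⬝ᵥ ofLp x) ∂(multivariateGaussian 0 S) := by
  have h1 := absorption_const_eq_integral hS.inv K hQ b
  have h2 := absorption_const_closed_form hS.inv K hQ
  have h3 := absorption_const_pos hS.inv K hQ b
  rw [inv_inv_of_posDef hS] at h1 h3
  exact ⟨by rw [← h1, h2], h3⟩

/-- **THE ROAD'S SIGN CONVENTION** `e^{−⟨b,x⟩ − ½⟨x,Kx⟩}`: for EVERY `F`,
`∫ e^{−½xᵀKx−bᵀx}•F dN(0,S) = (∫ e^{−½xᵀKx−bᵀx} dN(0,S)) • ∫ F dN(−(S⁻¹+K)⁻¹b, (S⁻¹+K)⁻¹)`. [folklore] -/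
theorem absorption_integral_neg {S : Matrix ι ι ℝ} (hS : S.PosDef) (K : Matrix ι ι ℝ) (hQ : (S⁻¹ + K).PosDef) (b : ι → ℝ)
    (F : EuclideanSpace ℝ ι → G) :
    ∫ x, Real.exp (-(ofLp x ⬝ᵥ K *ᵥ ofLp x) / 2 - b ⬝ᵥ ofLp x) • F x ∂(multivariateGaussian 0 S) =
      (∫ x, Real.exp (-(ofLp x ⬝ᵥ K *ᵥ ofLp x) / 2 - b ⬝ᵥ ofLp x) ∂(multivariateGaussian 0 S)) •
        ∫ x, F x ∂(multivariateGaussian (toLp 2 (-((S⁻¹ + K)⁻¹ *ᵥ b))) (S⁻¹ + K)⁻¹) := by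
  have h := absorption_integral_cov hS K hQ (-b) F
  simp only [neg_dotProduct, ← sub_eq_add_neg, Matrix.mulVec_neg] at h
  exact h

end Covariance

/-! ## §5. Toy -/

/-- Toy (§1): translating the standard Gaussian by `μ` gives `N(μ, 1)`. -/
example (μ : EuclideanSpace ℝ ι) : (multivariateGaussian 0 (1 : Matrix ι ι ℝ)).map (fun x => x + μ) = multivariateGaussian μ 1 :=
  multivariateGaussian_map_add μ 1

end Summit.QuantumFields.BalabanUV.T4Continuum.NE7b.SupGaussianQuadraticAbsorption
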